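import Mathlib
import Summits.Ventures.PercRepro2.Defs
import Summits.Ventures.PercRepro2.Independence
import Summits.Ventures.PercRepro2.Harris
import Summits.Ventures.PercRepro2.Graph
import Summits.Ventures.PercRepro2.Exploration
import Summits.Ventures.PercRepro2.Events
import Summits.Ventures.PercRepro2.HCov
import Summits.Ventures.PercRepro2.HCovFns
import Summits.Ventures.PercRepro2.HCovSwap
import Summits.Ventures.PercRepro2.PendantRoot
import Summits.Ventures.PercRepro2.PendantO
import Summits.Ventures.PercRepro2.PendantB
import Summits.Ventures.PercRepro2.PendantBRow
import Summits.Ventures.PercRepro2.LeafStep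
import Summits.Ventures.PercRepro2.LeafStepT0
import Summits.Ventures.PercRepro2.LeafChain
import Summits.Ventures.PercRepro2.LeafEnds
import Summits.Ventures.PercRepro2.LeafPlus
import Summits.Ventures.PercRepro2.LeafEndsPlus
import Summits.Ventures.PercRepro2.LeafDelete
import Summits.Ventures.PercRepro2.LeafDeletePath

/-!
# `(HCOV)⁺` along pendant paths of any length (blind cell PercRepro2, p1 g8)

The triple `(HCOV) ∧ (LEAF) ∧ (Q1)` (`LeafEndsPlus.HCovTriple`) is unchanged by leaf deletion
(`HCovTriple_update_loop`) and propagates down a pendant edge (`HCovTriple_of_leaf`); with the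
list predicate `LeafDelete.PendantPath` this gives **`(HCOV)⁺` at every vertex of a pendant path of
any length from `(HCOV)⁺` at its attachment vertex** (`HCovTriple_pendantPath`), in particular at
the end of every pendant path attached to a marked vertex `x ∈ {o, b, a₁, a₂}`
(`HCovTriple_pendantPath_marked`), for all weights. The length-two form with explicit degree-two
hypotheses is `HCovTriple_pendant_path`.
-/

namespace Summit.Ventures.PercRepro2

open UnionCluster CovForm PendantRoot PendantO LeafStep

namespace LeafDelete

variable {V : Type*} {E : Type*} [Fintype E] [DecidableEq E] [Fintype V] [DecidableEq V]
  {R : Type*} [Field R] [LinearOrder R] [IsStrictOrderedRing R] (p : E → R)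

omit [Fintype V] [DecidableEq V] [IsStrictOrderedRing R] in
/-- The triple is unchanged by leaf deletion. -/
lemma HCovTriple_update_loop {ends : E → Sym2 V} {f : E} {a₃ v : V} (hf : ends f = s(a₃, v))
    (hleaf : ∀ e, a₃ ∈ ends e → e = f) (h3v : a₃ ≠ v) {o a₁ a₂ w b : V} (ho : o ≠ a₃)
    (h1 : a₁ ≠ a₃) (h2 : a₂ ≠ a₃) (hw : w ≠ a₃) (hb : b ≠ a₃) :
    HCovTriple p (Function.update ends f s(a₃, a₃)) o a₁ a₂ w b ↔ HCovTriple p ends o a₁ a₂ w b := by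
  unfold HCovTriple
  rw [HCov_update_loop p hf hleaf h3v ho h1 h2 hw hb, LeafRow_update_loop p hf hleaf h3v ho h1 h2 hw hb,
    Q1Row_update_loop p hf hleaf h3v ho h1 h2 hw hb]

variable (ends : E → Sym2 V)

/-- **The corrected pendant-path composition for the triple**: `a₃` a leaf at `v` (edge `f`), `v` of
degree two with the other edge `g = s(v, w)`; the triple at `w` gives the triple at `a₃` and at `v`. -/
theorem HCovTriple_pendant_path (hp : IsProbVec p) {f g : E} {a₃ v w : V} (hf : ends f = s(a₃, v))
    (hleaf₃ : ∀ e, a₃ ∈ ends e → e = f) (h3v : a₃ ≠ v) (hg : ends g = s(v, w))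
    (hdeg : ∀ e, v ∈ ends e → e = g ∨ e = f) (hvw : v ≠ w) (h3w : a₃ ≠ w) {o a₁ a₂ b : V}
    (h31 : a₃ ≠ a₁) (h32 : a₃ ≠ a₂) (ho3 : o ≠ a₃) (hb3 : b ≠ a₃) (hv1 : v ≠ a₁) (hv2 : v ≠ a₂)
    (hov : o ≠ v) (hbv : b ≠ v) (hw : HCovTriple p ends o a₁ a₂ w b) :
    HCovTriple p ends o a₁ a₂ a₃ b ∧ HCovTriple p ends o a₁ a₂ v b := by
  have hw' : HCovTriple p (Function.update ends f s(a₃, a₃)) o a₁ a₂ w b :=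
    (HCovTriple_update_loop p hf hleaf₃ h3v ho3 h31.symm h32.symm h3w.symm hb3).2 hw
  have hv' : HCovTriple p (Function.update ends f s(a₃, a₃)) o a₁ a₂ v b :=
    HCovTriple_of_leaf p _ hp (ends_update_loop_of_ne hf h3v hg h3w) (leaf_update_loop hf h3v hdeg)
      hvw hv1 hv2 hov hbv hw'
  have hv : HCovTriple p ends o a₁ a₂ v b :=
    (HCovTriple_update_loop p hf hleaf₃ h3v ho3 h31.symm h32.symm h3v.symm hb3).1 hv'
  exact ⟨HCovTriple_of_leaf p ends hp hf hleaf₃ h3v h31 h32 ho3 hb3 hv, hv⟩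

/-- **`(HCOV)⁺` along a pendant path of ANY length**: the triple at the attachment vertex `x` gives
the triple at every vertex of a pendant path attached at `x` whose vertices avoid the marks. -/
theorem HCovTriple_pendantPath (hp : IsProbVec p) {o a₁ a₂ b x : V} :
    ∀ (vs : List V) (es : List E) (ends : E → Sym2 V), PendantPath ends none vs es x →
      (∀ v ∈ vs, v ≠ o ∧ v ≠ b ∧ v ≠ a₁ ∧ v ≠ a₂) → HCovTriple p ends o a₁ a₂ x b →
      ∀ v ∈ vs, HCovTriple p ends o a₁ a₂ v b := by
  intro vs
  induction vs with
  | nil => intro _ _ _ _ _ v hv; simp at hv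
  | cons v vs ih =>
    intro es ends h hm hx u hu
    cases es with
    | nil => exact (h : False).elim
    | cons e es =>
      have h' := h
      obtain ⟨he, hne, hnin, hnx, hdeg, _⟩ := h'
      obtain ⟨hvo, hvb, hv1, hv2⟩ := hm v (by simp)
      have hleaf : ∀ e', v ∈ ends e' → e' = e := by
        intro e' he'
        rcases hdeg e' he' with h | h
        · exact h
        · exact absurd h (by simp)
      have hpath' := pendantPath_update_head vs es h hnx.symm
      have hx' : HCovTriple p (Function.update ends e s(v, v)) o a₁ a₂ x b :=
        (HCovTriple_update_loop p he hleaf hne (ne_comm.1 hvo) hv1.symm hv2.symm hnx.symm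
          (ne_comm.1 hvb)).2 hx
      have hall' := ih es _ hpath' (fun u hu => hm u (by simp [hu])) hx'
      have hnext' : HCovTriple p (Function.update ends e s(v, v)) o a₁ a₂ (vs.headD x) b := by
        cases vs with
        | nil => exact hx'
        | cons w ws => exact hall' w (by simp)
      have hnext : HCovTriple p ends o a₁ a₂ (vs.headD x) b :=
        (HCovTriple_update_loop p he hleaf hne (ne_comm.1 hvo) hv1.symm hv2.symm hne.symm
          (ne_comm.1 hvb)).1 hnext'
      have hv : HCovTriple p ends o a₁ a₂ v b :=
        HCovTriple_of_leaf p ends hp he hleaf hne hv1 hv2 hvo.symm hvb.symm hnext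
      rcases List.mem_cons.1 hu with rfl | hu'
      · exact hv
      · have hu3 : u ≠ v := fun h => hnin (h ▸ hu')
        exact (HCovTriple_update_loop p he hleaf hne (ne_comm.1 hvo) hv1.symm hv2.symm hu3
          (ne_comm.1 hvb)).1 (hall' u hu')

/-- **`(HCOV)⁺` at the end of a pendant path of any length attached to a marked vertex
`x ∈ {o, b, a₁, a₂}`** (all weights): every vertex of the path, in particular its leaf end, satisfies
(HCOV), the leaf row and (Q1). -/
theorem HCovTriple_pendantPath_marked (hp : IsProbVec p) {o a₁ a₂ b x : V}
    (hx : x = o ∨ x = b ∨ x = a₁ ∨ x = a₂) (vs : List V) (es : List E)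
    (h : PendantPath ends none vs es x) (hm : ∀ v ∈ vs, v ≠ o ∧ v ≠ b ∧ v ≠ a₁ ∧ v ≠ a₂) :
    ∀ v ∈ vs, HCovTriple p ends o a₁ a₂ v b :=
  HCovTriple_pendantPath p hp vs es ends h hm (HCovTriple_marked p ends hp hx)

end LeafDelete

end Summit.Ventures.PercRepro2
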